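import Summits.MatrixMultiplication.MatrixMultiplication.Theorems.SoloInformedCwTwoCayley
import Summits.MatrixMultiplication.MatrixMultiplication.Theorems.SoloInformedCwTwoNormalForms
import HarnessLib

/-!
# Census of NO instances `P ⋭ N_k`, `cw₂ ⋭ N_k` via the Cayley form

Solo programme `solo-MatrixMultiplication-informed`, generation 26 (second file; the tool is
`SoloInformedCwTwoCayley.lean`: `rank Ω` does not increase under `PolyDegeneratesTo`).
Certificates (`decide +kernel` on integer code matrices, valid in every characteristic through the
tree's unit-pivot row certificates and explicit kernel vectors): `rank Ω_P ≤ 22`, `rank Ω_{cw₂} ≤ 22`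
over every field, `rank Ω_P ≤ 16` in characteristic `2`; `rank Ω_{N_k} ≥ 24` for Nurmiev's normal
forms `k = 1, 2, 4` and `≥ 18` for `k = 9, 18`.  Consequences over EVERY field `K`: `P ⋭ N₁, N₂, N₄`,
`cw₂ ⋭ N₁, N₂, N₄`; `P ⋭ N₉, N₁₈` when `2 = 0` in `K` (so `P ⊵ N₉ ⟺ char K ≠ 2`).  With the `21` YES
certificates of `SoloInformedCwTwoNormalForms` this decides `cw₂ ⊵ N_k` over `ℂ` for all `24`
nilpotent normal forms (`cwTensor_two_polyDegeneratesTo_nurmiev_iff`: iff `k ∉ {1, 2, 4}`; `N₄` has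
the support ranks of closure members — no support argument excludes it, the covariant `Ω` does).
Sources: [cite: Nurmiev2000, Table 2]; [cite: ConnerGesmundoLandsbergVentura2022, §3.2];
[cite: Alman2021, §2.4].  Everything here is PROVED; no new axioms.
-/

namespace Summit.MatrixMultiplication.MatrixMultiplication.Theorems

open Matrix Finset
open Literature.Computability.AlgebraicComplexity Literature.Barriers.MatrixMultiplication Literature.LinearAlgebra.Matrix

universe u

namespace CayleyOmega

/-! ## Kernel-evaluable presentations -/

section Cert

/-- Decode `r = 9a + 3b + c < 27` to `(a, b, c)`. [folklore] -/
def dec (r : ℕ) : Idx := (finCode 3 (r / 9), finCode 3 (r / 3), finCode 3 r)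

/-- Encode `(a, b, c) ↦ 9a + 3b + c`. [folklore] -/
def enc (p : Idx) : ℕ := 9 * (p.1 : ℕ) + 3 * (p.2.1 : ℕ) + (p.2.2 : ℕ)

/-- `dec ∘ enc = id`. [folklore] -/
theorem dec_enc (p : Idx) : dec (enc p) = p := by
  obtain ⟨a, b, c⟩ := p; fin_cases a <;> fin_cases b <;> fin_cases c <;> rfl

/-- Codes are `< 27`. [folklore] -/
theorem enc_lt (p : Idx) : enc p < 27 := by
  obtain ⟨a, b, c⟩ := p
  have ha := a.isLt; have hb := b.isLt; have hc := c.isLt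
  simp only [enc]; omega

/-- List-based integer presentation of `Ω_N` on codes (for `decide`). [folklore] -/
def code (N : Fin 3 → Fin 3 → Fin 3 → ℤ) (r c : ℕ) : ℤ :=
  KYCert.lsum 3 fun x => KYCert.lsum 3 fun y => KYCert.lsum 3 fun z =>
    N (finCode 3 x) (finCode 3 y) (finCode 3 z) *
      (leviCivita3Table (finCode 3 x) (finCode 3 (r / 9)) (finCode 3 (c / 9)) *
        leviCivita3Table (finCode 3 y) (finCode 3 (r / 3)) (finCode 3 (c / 3)) *
        leviCivita3Table (finCode 3 z) (finCode 3 r) (finCode 3 c))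

/-- The code matrix IS `Ω_N` read through the decoder. [folklore] -/
theorem code_eq (N : Fin 3 → Fin 3 → Fin 3 → ℤ) (r c : ℕ) : code N r c = cayleyForm N (dec r) (dec c) := by
  have hf : ∀ i : Fin 3, finCode 3 (i : ℕ) = i := fun i => Fin.ext (Nat.mod_eq_of_lt i.isLt)
  simp only [code, cayleyForm, KYCert.lsum_eq, hf, Fintype.sum_prod_type, Int.cast_id, dec]

/-- **Rank lower bounds in every characteristic** from a unit-pivot certificate of the code matrix. [folklore] -/
theorem le_rank_cayleyForm_of_cert {F : Type*} [Field F] (N : Fin 3 → Fin 3 → Fin 3 → ℤ) {n : ℕ}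
    {rows : List (List (ℕ × ℤ))} {piv : List ℕ} (h : intTriCheckUnit n (code N) rows piv = true) :
    n ≤ (cayleyForm (fun a b c => (N a b c : F))).rank := by
  have e : code N = fun r c => cayleyForm N (dec r) (dec c) :=
    funext fun r => funext fun c => code_eq N r c
  rw [e] at h
  have := le_rank_of_intTriCheckUnit (F := F) (cayleyForm N) dec dec h
  rwa [cayleyForm_map_intCast] at this

/-- A sparse integer vector on `{0,1,2}³` given by `(code, coefficient)` pairs. [folklore] -/
def spVec : List (ℕ × ℤ) → Idx → ℤ
  | [], _ => 0
  | qc :: L, q => (if dec qc.1 = q then qc.2 else 0) + spVec L q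

/-- Pairing with a sparse vector is the sparse sum. [folklore] -/
theorem sum_mul_spVec (g : Idx → ℤ) (L : List (ℕ × ℤ)) :
    ∑ q, g q * spVec L q = (L.map fun qc : ℕ × ℤ => qc.2 * g (dec qc.1)).sum := by
  induction L with
  | nil => simp [spVec]
  | cons qc L ih =>
    simp only [spVec, mul_add, Finset.sum_add_distrib, ih, List.map_cons, List.sum_cons, mul_ite,
      mul_zero, Finset.sum_ite_eq, Finset.mem_univ, if_true]
    ring

/-- The `27 × k` integer matrix whose columns are the listed sparse vectors. [folklore] -/
def spMat (Ls : List (List (ℕ × ℤ))) (k : ℕ) : Matrix Idx (Fin k) ℤ :=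
  fun q i => spVec (Ls.getD (i : ℕ) []) q

/-- The kernel test: every listed vector is killed by `Ω_N` modulo `d` (`d = 0`: exactly), on codes.
[folklore] -/
def kerCheck (d : ℤ) (N : Fin 3 → Fin 3 → Fin 3 → ℤ) (k : ℕ) (Ls : List (List (ℕ × ℤ))) : Bool :=
  (List.range 27).all fun r => (List.range k).all fun i =>
    ((Ls.getD i []).map fun qc : ℕ × ℤ => qc.2 * code N r qc.1).sum % d == 0

/-- Soundness of the kernel test: `d ∣ (Ω_N · W)_{p i}`. [folklore] -/
theorem dvd_of_kerCheck {d : ℤ} {N : Fin 3 → Fin 3 → Fin 3 → ℤ} {k : ℕ} {Ls : List (List (ℕ × ℤ))}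
    (h : kerCheck d N k Ls = true) (p : Idx) (i : Fin k) :
    d ∣ (cayleyForm N * spMat Ls k) p i := by
  rw [← dec_enc p]
  unfold kerCheck at h
  rw [List.all_eq_true] at h
  have h1 := h (enc p) (List.mem_range.2 (enc_lt p))
  rw [List.all_eq_true] at h1
  have h2 := h1 i (List.mem_range.2 i.isLt)
  simp only [beq_iff_eq, code_eq] at h2
  rw [Matrix.mul_apply]
  simp only [spMat]
  rw [sum_mul_spVec]
  exact Int.dvd_of_emod_eq_zero h2

/-- **Rank upper bounds** from certified kernel vectors: if `Ω_N · W ≡ 0 (mod d)`, `d = 0` in `F`,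
and `W` has `k` certified independent columns, then `rank_F Ω_N + k ≤ 27`. [folklore] -/
theorem rank_cayleyForm_add_le_of_kerCheck {F : Type*} [Field F] {d : ℤ} (hd : (d : F) = 0)
    {N : Fin 3 → Fin 3 → Fin 3 → ℤ} {k : ℕ} {Ls : List (List (ℕ × ℤ))}
    (h : kerCheck d N k Ls = true) (fc : ℕ → Fin k) {rows : List (List (ℕ × ℤ))} {piv : List ℕ}
    (hW : intTriCheckUnit k (fun r c => spMat Ls k (dec r) (fc c)) rows piv = true) :
    (cayleyForm (fun a b c => (N a b c : F))).rank + k ≤ 27 := by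
  have hW' := le_rank_of_intTriCheckUnit (F := F) (spMat Ls k) dec fc hW
  have hprod : cayleyForm (fun a b c => (N a b c : F)) * (spMat Ls k).map (Int.cast : ℤ → F) = 0 := by
    ext p i
    obtain ⟨y, hy⟩ := dvd_of_kerCheck h p i
    rw [Matrix.mul_apply] at hy
    simp only [Matrix.mul_apply, Matrix.map_apply, Matrix.zero_apply, cayleyForm_intCast,
      ← Int.cast_mul, ← Int.cast_sum, hy]
    rw [Int.cast_mul, hd, zero_mul]
  have := Matrix.rank_add_rank_le_card_of_mul_eq_zero hprod
  simp only [Fintype.card_prod, Fintype.card_fin] at this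
  omega

end Cert

/-! ## The data -/

section Data

/-- `cw₂` over `ℤ`: `1` at `(0,j,j), (j,0,j), (j,j,0)`, `j = 1, 2`. [cite: ConnerGesmundoLandsbergVentura2022, §3.2] -/
def cwTwoInt : Fin 3 → Fin 3 → Fin 3 → ℤ :=
  ApproxCert.ofEntries 3 3 3
    [((0, 1, 1), 1), ((1, 0, 1), 1), ((1, 1, 0), 1), ((0, 2, 2), 1), ((2, 0, 2), 1), ((2, 2, 0), 1)]

/-- The tree's `cwTensor K 2` is `cwTwoInt` read in `K`. [cite: ConnerGesmundoLandsbergVentura2022, §3.2] -/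
theorem cwTensor_two_eq_cast (K : Type*) [CommRing K] :
    cwTensor K 2 = fun a b c => (cwTwoInt a b c : K) := by
  have hc : ∀ a b c : Fin 3, cwTwoInt a b c =
      if (a = 0 ∧ b = c ∧ b ≠ 0) ∨ (b = 0 ∧ a = c ∧ a ≠ 0) ∨ (c = 0 ∧ a = b ∧ a ≠ 0)
      then 1 else 0 := by decide
  funext a b c
  rw [cwTensor_apply, hc]
  split_ifs <;> simp

/-- The `5` kernel vectors of `Ω_P` (sparse `(code, coeff)` lists): `e_{iii}, Σ_cyc e₀₁₂, Σ_cyc e₀₂₁`. [folklore] -/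
def sThreeKer : List (List (ℕ × ℤ)) :=
  [[(0, 1)], [(13, 1)], [(5, 1), (15, 1), (19, 1)], [(7, 1), (11, 1), (21, 1)], [(26, 1)]]

/-- The `11` kernel vectors of `Ω_P` mod `2`: `e_{iii}` and the eight `ℤ/3`-orbit sums. [folklore] -/
def sThreeKerTwo : List (List (ℕ × ℤ)) :=
  [[(0, 1)], [(1, 1), (3, 1), (9, 1)], [(4, 1), (10, 1), (12, 1)], [(13, 1)],
    [(2, 1), (6, 1), (18, 1)], [(5, 1), (15, 1), (19, 1)], [(7, 1), (11, 1), (21, 1)],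
    [(14, 1), (16, 1), (22, 1)], [(8, 1), (20, 1), (24, 1)], [(17, 1), (23, 1), (25, 1)], [(26, 1)]]

/-- The `5` integer kernel vectors of `Ω_{cw₂}`. [folklore] -/
def cwTwoKer : List (List (ℕ × ℤ)) :=
  [[(0, 1)], [(5, -1), (7, 1), (11, 1), (15, -1), (19, -1), (21, 1)],
    [(4, 1), (8, 1), (10, 1), (12, 1), (20, 1), (24, 1)], [(13, -1), (17, 1), (23, 1), (25, 1)],
    [(14, -1), (16, -1), (22, -1), (26, 1)]]

/-- `Ω_P` kills `sThreeKer`. [folklore] -/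
theorem sThree_kerCheck : kerCheck 0 sThreeInt 5 sThreeKer = true := by decide +kernel

/-- `sThreeKer` has rank `5`. [folklore] -/
theorem sThree_kerW : intTriCheckUnit 5 (fun r c => spMat sThreeKer 5 (dec r) (finCode 5 c))
    [[(0, 1)], [(13, 1)], [(5, 1)], [(7, 1)], [(26, 1)]] [0, 1, 2, 3, 4] = true := by
  decide +kernel

/-- `Ω_P` kills `sThreeKerTwo` modulo `2`. [folklore] -/
theorem sThree_kerCheck_two : kerCheck 2 sThreeInt 11 sThreeKerTwo = true := by decide +kernel

/-- `sThreeKerTwo` has rank `11` in every characteristic. [folklore] -/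
theorem sThree_kerW_two :
    intTriCheckUnit 11 (fun r c => spMat sThreeKerTwo 11 (dec r) (finCode 11 c))
      [[(0, 1)], [(1, 1)], [(4, 1)], [(13, 1)], [(2, 1)], [(5, 1)], [(7, 1)], [(14, 1)], [(8, 1)],
        [(17, 1)], [(26, 1)]] [0, 1, 2, 3, 4, 5, 6, 7, 8, 9, 10] = true := by
  decide +kernel

/-- `Ω_{cw₂}` kills `cwTwoKer`. [folklore] -/
theorem cwTwo_kerCheck : kerCheck 0 cwTwoInt 5 cwTwoKer = true := by decide +kernel

/-- `cwTwoKer` has rank `5`. [folklore] -/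
theorem cwTwo_kerW : intTriCheckUnit 5 (fun r c => spMat cwTwoKer 5 (dec r) (finCode 5 c))
    [[(0, 1)], [(5, 1)], [(4, 1)], [(13, 1)], [(14, 1)]] [0, 1, 2, 3, 4] = true := by
  decide +kernel

/-- `rank Ω_{N₁} ≥ 24` certificate. [cite: Nurmiev2000, Table 2] -/
theorem nurmiev_one_cert : intTriCheckUnit 24 (code (nurmievInt 1))
    [[(0, 1)], [(1, 1)], [(2, 1)], [(3, 1)], [(4, 1)], [(5, 1)], [(2, -1), (6, 1)], [(7, 1)], [(8, 1)],
      [(10, 1)], [(11, 1)], [(13, 1)], [(14, 1)], [(15, 1)], [(16, 1)], [(17, 1)], [(16, -1), (19, 1)],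
      [(17, -1), (20, 1)], [(14, -1), (21, 1)], [(17, 1), (20, -1), (22, 1)], [(23, 1)],
      [(17, -2), (20, 1), (22, -1), (24, 1)], [(25, 1)], [(26, 1)]]
    [26, 23, 22, 25, 17, 16, 20, 14, 13, 24, 21, 8, 7, 19, 5, 4, 15, 6, 11, 2, 1, 10, 3, 0] = true := by
  decide +kernel

/-- `rank Ω_{N₂} ≥ 24` certificate. [cite: Nurmiev2000, Table 2] -/
theorem nurmiev_two_cert : intTriCheckUnit 24 (code (nurmievInt 2))
    [[(0, 1)], [(2, 1)], [(3, 1)], [(2, -1), (3, 1), (4, 1)], [(5, 1)], [(6, 1)], [(6, 1), (7, 1)],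
      [(8, 1)], [(3, -1), (9, 1)], [(11, 1)], [(6, -1), (12, 1)], [(13, 1)], [(14, 1)], [(15, 1)],
      [(16, 1)], [(17, 1)], [(13, -1), (19, 1)], [(14, -1), (20, 1)], [(14, -1), (21, 1)],
      [(14, 1), (20, -1), (22, 1)], [(23, 1)], [(17, -1), (24, 1)],
      [(17, -1), (23, -1), (24, 1), (25, 1)], [(26, 1)]]
    [26, 24, 25, 17, 16, 20, 14, 13, 23, 21, 22, 8, 7, 19, 5, 4, 15, 6, 11, 12, 9, 2, 3, 0] = true := by
  decide +kernel

/-- `rank Ω_{N₄} ≥ 24` certificate. [cite: Nurmiev2000, Table 2] -/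
theorem nurmiev_four_cert : intTriCheckUnit 24 (code (nurmievInt 4))
    [[(1, 1)], [(2, 1)], [(3, 1)], [(4, 1)], [(5, 1)], [(6, 1)], [(7, 1)], [(8, 1)], [(10, 1)],
      [(11, 1)], [(12, 1)], [(13, 1)], [(14, 1)], [(7, -1), (15, 1)], [(16, 1)], [(17, 1)], [(18, 1)],
      [(19, 1)], [(20, 1)], [(19, -1), (21, 1)], [(22, 1)], [(23, 1)], [(13, -1), (25, 1)],
      [(14, -1), (26, 1)]]
    [14, 13, 26, 11, 10, 23, 20, 19, 5, 4, 25, 2, 1, 22, 21, 18, 17, 8, 7, 16, 15, 6, 12, 3] = true := by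
  decide +kernel

/-- `rank Ω_{N₉} ≥ 18` certificate. [cite: Nurmiev2000, Table 2] -/
theorem nurmiev_nine_cert : intTriCheckUnit 18 (code (nurmievInt 9))
    [[(0, 1)], [(1, 1)], [(2, 1)], [(3, 1)], [(4, 1)], [(6, 1)], [(9, 1)], [(14, 1)], [(16, 1)],
      [(18, 1)], [(19, 1)], [(20, 1)], [(21, 1)], [(22, 1)], [(23, 1)], [(24, 1)], [(25, 1)],
      [(22, -1), (26, 1)]]
    [22, 21, 24, 19, 18, 20, 26, 25, 23, 4, 3, 6, 1, 0, 16, 2, 14, 9] = true := by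
  decide +kernel

/-- `rank Ω_{N₁₈} ≥ 18` certificate. [cite: Nurmiev2000, Table 2] -/
theorem nurmiev_eighteen_cert : intTriCheckUnit 18 (code (nurmievInt 18))
    [[(0, 1)], [(1, 1)], [(3, 1)], [(6, 1)], [(7, 1)], [(8, 1)], [(15, 1)], [(16, 1)],
      [(7, -1), (17, 1)], [(18, 1)], [(19, 1)], [(20, 1)], [(21, 1)], [(22, 1)], [(19, -1), (23, 1)],
      [(24, 1)], [(25, 1)], [(26, 1)]]
    [25, 24, 26, 19, 18, 21, 20, 23, 22, 7, 6, 15, 8, 17, 16, 1, 0, 3] = true := by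
  decide +kernel

end Data

/-! ## Rank bounds over every field and the non-degenerations -/

section Bounds

/-- **`rank Ω_P ≤ 22`** over every field. [folklore] -/
theorem cayleyRank_sThree_le (F : Type*) [Field F] : (cayleyForm (sThree F)).rank ≤ 22 := by
  have h := rank_cayleyForm_add_le_of_kerCheck (F := F) (d := 0) (by simp) sThree_kerCheck
    (finCode 5) sThree_kerW
  change (cayleyForm (fun a b c => (sThreeInt a b c : F))).rank ≤ 22
  omega

/-- **`rank Ω_P ≤ 16` in characteristic `2`.** [folklore] -/
theorem cayleyRank_sThree_le_of_two (F : Type*) [Field F] (h2 : (2 : F) = 0) :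
    (cayleyForm (sThree F)).rank ≤ 16 := by
  have h := rank_cayleyForm_add_le_of_kerCheck (F := F) (d := 2) (by simpa using h2)
    sThree_kerCheck_two (finCode 11) sThree_kerW_two
  change (cayleyForm (fun a b c => (sThreeInt a b c : F))).rank ≤ 16
  omega

/-- **`rank Ω_{cw₂} ≤ 22`** over every field. [cite: ConnerGesmundoLandsbergVentura2022, §3.2] -/
theorem cayleyRank_cwTwo_le (F : Type*) [Field F] :
    (cayleyForm (fun a b c => (cwTwoInt a b c : F))).rank ≤ 22 := by
  have h := rank_cayleyForm_add_le_of_kerCheck (F := F) (d := 0) (by simp) cwTwo_kerCheck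
    (finCode 5) cwTwo_kerW
  omega

/-- **`rank Ω_{N₁} ≥ 24`** over every field. [cite: Nurmiev2000, Table 2] -/
theorem le_cayleyRank_nurmiev_one (F : Type*) [Field F] : 24 ≤ (cayleyForm (nurmiev F 1)).rank :=
  le_rank_cayleyForm_of_cert (F := F) (nurmievInt 1) nurmiev_one_cert

/-- **`rank Ω_{N₂} ≥ 24`** over every field. [cite: Nurmiev2000, Table 2] -/
theorem le_cayleyRank_nurmiev_two (F : Type*) [Field F] : 24 ≤ (cayleyForm (nurmiev F 2)).rank :=
  le_rank_cayleyForm_of_cert (F := F) (nurmievInt 2) nurmiev_two_cert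

/-- **`rank Ω_{N₄} ≥ 24`** over every field. [cite: Nurmiev2000, Table 2] -/
theorem le_cayleyRank_nurmiev_four (F : Type*) [Field F] : 24 ≤ (cayleyForm (nurmiev F 4)).rank :=
  le_rank_cayleyForm_of_cert (F := F) (nurmievInt 4) nurmiev_four_cert

/-- **`rank Ω_{N₉} ≥ 18`** over every field. [cite: Nurmiev2000, Table 2] -/
theorem le_cayleyRank_nurmiev_nine (F : Type*) [Field F] : 18 ≤ (cayleyForm (nurmiev F 9)).rank :=
  le_rank_cayleyForm_of_cert (F := F) (nurmievInt 9) nurmiev_nine_cert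

/-- **`rank Ω_{N₁₈} ≥ 18`** over every field. [cite: Nurmiev2000, Table 2] -/
theorem le_cayleyRank_nurmiev_eighteen (F : Type*) [Field F] :
    18 ≤ (cayleyForm (nurmiev F 18)).rank :=
  le_rank_cayleyForm_of_cert (F := F) (nurmievInt 18) nurmiev_eighteen_cert

end Bounds

section NonDegeneration

variable (K : Type u) [Field K]

/-- `P` degenerates only to tensors with `rank Ω ≤ 22`. [cite: Alman2021, §2.4] -/
theorem cayleyRank_le_of_sThree_degen {N : Fin 3 → Fin 3 → Fin 3 → K}
    (h : PolyDegeneratesTo (sThree K) N) : (cayleyForm N).rank ≤ 22 :=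
  rank_cayleyForm_le_of_polyDegeneratesTo sThreeInt h (by
    intro L _ _
    exact cayleyRank_sThree_le L)

/-- In characteristic `2`, `P` degenerates only to tensors with `rank Ω ≤ 16`.
[cite: Alman2021, §2.4] -/
theorem cayleyRank_le_of_sThree_degen_of_two (h2 : (2 : K) = 0) {N : Fin 3 → Fin 3 → Fin 3 → K}
    (h : PolyDegeneratesTo (sThree K) N) : (cayleyForm N).rank ≤ 16 :=
  rank_cayleyForm_le_of_polyDegeneratesTo sThreeInt h (by
    intro L _ φ
    refine cayleyRank_sThree_le_of_two L ?_
    rw [show (2 : L) = φ 2 from (map_ofNat φ 2).symm, h2, map_zero])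

/-- `cw₂` degenerates only to tensors with `rank Ω ≤ 22`. [cite: Alman2021, §2.4] -/
theorem cayleyRank_le_of_cwTwo_degen {N : Fin 3 → Fin 3 → Fin 3 → K}
    (h : PolyDegeneratesTo (cwTensor K 2) N) : (cayleyForm N).rank ≤ 22 := by
  rw [cwTensor_two_eq_cast] at h
  exact rank_cayleyForm_le_of_polyDegeneratesTo cwTwoInt h (by
    intro L _ _
    exact cayleyRank_cwTwo_le L)

/-- Bookkeeping: `m ≤ a ≤ n < m` is absurd. [folklore] -/
theorem rank_absurd {a m n : ℕ} (h1 : m ≤ a) (h2 : a ≤ n) (h : n < m) : False := by omega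

/-- **`P ⋭ N₁`** over every field. [cite: Nurmiev2000, Table 2] -/
theorem not_sThree_polyDegeneratesTo_nurmiev_one : ¬ PolyDegeneratesTo (sThree K) (nurmiev K 1) :=
  fun h => rank_absurd (le_cayleyRank_nurmiev_one K) (cayleyRank_le_of_sThree_degen K h) (by omega)

/-- **`P ⋭ N₂`** over every field. [cite: Nurmiev2000, Table 2] -/
theorem not_sThree_polyDegeneratesTo_nurmiev_two : ¬ PolyDegeneratesTo (sThree K) (nurmiev K 2) :=
  fun h => rank_absurd (le_cayleyRank_nurmiev_two K) (cayleyRank_le_of_sThree_degen K h) (by omega)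

/-- **`P ⋭ N₄`** over every field (the class with the support ranks of closure members).
[cite: Nurmiev2000, Table 2] -/
theorem not_sThree_polyDegeneratesTo_nurmiev_four : ¬ PolyDegeneratesTo (sThree K) (nurmiev K 4) :=
  fun h => rank_absurd (le_cayleyRank_nurmiev_four K) (cayleyRank_le_of_sThree_degen K h) (by omega)

/-- **`P ⋭ N₉` in characteristic `2`.** [cite: Nurmiev2000, Table 2] -/
theorem not_sThree_polyDegeneratesTo_nurmiev_nine_of_two (h2 : (2 : K) = 0) :
    ¬ PolyDegeneratesTo (sThree K) (nurmiev K 9) := fun h =>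
  rank_absurd (le_cayleyRank_nurmiev_nine K) (cayleyRank_le_of_sThree_degen_of_two K h2 h) (by omega)

/-- **`P ⋭ N₁₈` in characteristic `2`.** [cite: Nurmiev2000, Table 2] -/
theorem not_sThree_polyDegeneratesTo_nurmiev_eighteen_of_two (h2 : (2 : K) = 0) :
    ¬ PolyDegeneratesTo (sThree K) (nurmiev K 18) := fun h =>
  rank_absurd (le_cayleyRank_nurmiev_eighteen K) (cayleyRank_le_of_sThree_degen_of_two K h2 h)
    (by omega)

/-- **`P ⊵ N₉ ⟺ char K ≠ 2`** over a field (`N₉` joins the eight classes of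
`SoloInformedCwTwoShadowCharTwoIff`; certificate multiplier `4`). [cite: Nurmiev2000, Table 2] -/
theorem sThree_polyDegeneratesTo_nurmiev_nine_iff :
    PolyDegeneratesTo (sThree K) (nurmiev K 9) ↔ (2 : K) ≠ 0 := by
  refine ⟨fun h h2 => not_sThree_polyDegeneratesTo_nurmiev_nine_of_two K h2 h, fun h2 => ?_⟩
  have hD4 : IsUnit (((4 : ℤ) : K)) := by
    rw [Int.cast_ofNat, show (4 : K) = 2 * 2 by norm_num]
    exact isUnit_iff_ne_zero.mpr (mul_ne_zero h2 h2)
  exact DegenCert.polyDegeneratesTo_of_check K sThree_nurmiev_9_check hD4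

/-- **`cw₂ ⋭ N₁`** over every field. [cite: ConnerGesmundoLandsbergVentura2022, §3.2] -/
theorem not_cwTensor_two_polyDegeneratesTo_nurmiev_one :
    ¬ PolyDegeneratesTo (cwTensor K 2) (nurmiev K 1) :=
  fun h => rank_absurd (le_cayleyRank_nurmiev_one K) (cayleyRank_le_of_cwTwo_degen K h) (by omega)

/-- **`cw₂ ⋭ N₂`** over every field. [cite: ConnerGesmundoLandsbergVentura2022, §3.2] -/
theorem not_cwTensor_two_polyDegeneratesTo_nurmiev_two :
    ¬ PolyDegeneratesTo (cwTensor K 2) (nurmiev K 2) :=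
  fun h => rank_absurd (le_cayleyRank_nurmiev_two K) (cayleyRank_le_of_cwTwo_degen K h) (by omega)

/-- **`cw₂ ⋭ N₄`** over every field. [cite: ConnerGesmundoLandsbergVentura2022, §3.2] -/
theorem not_cwTensor_two_polyDegeneratesTo_nurmiev_four :
    ¬ PolyDegeneratesTo (cwTensor K 2) (nurmiev K 4) :=
  fun h => rank_absurd (le_cayleyRank_nurmiev_four K) (cayleyRank_le_of_cwTwo_degen K h) (by omega)

/-- **Kernel census of `closure(GL₃(ℂ)³ · cw₂)` on Nurmiev's list**: for `1 ≤ k ≤ 24`,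
`cw₂ ⊵ N_k` over `ℂ` iff `k ∉ {1, 2, 4}` (YES side: `SoloInformedCwTwoNormalForms`).
[cite: Nurmiev2000, Table 2] -/
theorem cwTensor_two_polyDegeneratesTo_nurmiev_iff {k : ℕ} (hk₁ : 1 ≤ k) (hk₂ : k ≤ 24) :
    PolyDegeneratesTo (cwTensor ℂ 2) (nurmiev ℂ k) ↔ (k ≠ 1 ∧ k ≠ 2 ∧ k ≠ 4) := by
  constructor
  · intro h
    refine ⟨?_, ?_, ?_⟩ <;> rintro rfl
    · exact not_cwTensor_two_polyDegeneratesTo_nurmiev_one ℂ h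
    · exact not_cwTensor_two_polyDegeneratesTo_nurmiev_two ℂ h
    · exact not_cwTensor_two_polyDegeneratesTo_nurmiev_four ℂ h
  · rintro ⟨h1, h2, h4⟩
    apply cwTensor_two_polyDegeneratesTo_nurmiev_of_mem
    simp only [Finset.mem_insert, Finset.mem_singleton]
    omega

/-- The `24 × 24` Pfaffians of `Ω` vanish on the boundary: `rank Ω_{N_k} ≤ 22` for the `21` classes
below `cw₂`. [cite: Nurmiev2000, Table 2] -/
theorem cayleyRank_nurmiev_le_of_mem (k : ℕ)
    (hk : k ∈ ({3, 5, 6, 7, 8, 9, 10, 11, 12, 13, 14, 15, 16, 17, 18, 19, 20, 21, 22, 23, 24} : Finset ℕ)) :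
    (cayleyForm (nurmiev ℂ k)).rank ≤ 22 :=
  cayleyRank_le_of_cwTwo_degen ℂ (cwTensor_two_polyDegeneratesTo_nurmiev_of_mem k hk)

end NonDegeneration

end CayleyOmega

end Summit.MatrixMultiplication.MatrixMultiplication.Theorems
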